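import Mathlib
import Summits.Ventures.PercRepro2.Tail2DBlockCalc
import Summits.Ventures.PercRepro2.Tail2DHarrisSP
import Summits.Ventures.PercRepro2.Tail2DFlowOneBlocks
import Summits.Ventures.PercRepro2.Tail2DFlowOneStep01
import Summits.Ventures.PercRepro2.Tail2DParFin
import Summits.Ventures.PercRepro2.Tail2DParFinFlip
import Summits.Ventures.PercRepro2.Tail2DParFinTop
import Summits.Ventures.PercRepro2.Tail2DParFinDiag
import Summits.Ventures.PercRepro2.Tail2DParFinCount
import Summits.Ventures.PercRepro2.Tail2DParFinRelax
import Summits.Ventures.PercRepro2.Tail2DParFinSubTop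
import Summits.Ventures.PercRepro2.Tail2DParFinSubTopB
import Summits.Ventures.PercRepro2.Tail2DParFinSubTopD
import Summits.Ventures.PercRepro2.Tail2DParFinFibres
import Summits.Ventures.PercRepro2.Tail2DOneChange
import Summits.Ventures.PercRepro2.Tail2DOneChangeB
import Summits.Ventures.PercRepro2.Tail2DOneChangeC
import Summits.Ventures.PercRepro2.Tail2DFourIdent
import Summits.Ventures.PercRepro2.Tail2DSevIdent50
import Summits.Ventures.PercRepro2.Tail2DSevIdent41
import Summits.Ventures.PercRepro2.Tail2DSevIdent40
import Summits.Ventures.PercRepro2.Tail2DSevIdent40S1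
import Summits.Ventures.PercRepro2.Tail2DSevIdent40T1
import Summits.Ventures.PercRepro2.Tail2DSevIdent40Z
import Summits.Ventures.PercRepro2.Tail2DSevIdent31
import Summits.Ventures.PercRepro2.Tail2DSevIdent31S1
import Summits.Ventures.PercRepro2.Tail2DSevIdent31T1
import Summits.Ventures.PercRepro2.Tail2DSevIdent31Z
import Summits.Ventures.PercRepro2.Tail2DSevIdent30
import Summits.Ventures.PercRepro2.Tail2DSevIdent30S1
import Summits.Ventures.PercRepro2.Tail2DSevIdent30S2
import Summits.Ventures.PercRepro2.Tail2DSevIdent30T1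
import Summits.Ventures.PercRepro2.Tail2DSevIdent30T2
import Summits.Ventures.PercRepro2.Tail2DSevIdent30Z
import Summits.Ventures.PercRepro2.Tail2DSevIdent20
import Summits.Ventures.PercRepro2.Tail2DSevIdent20S1
import Summits.Ventures.PercRepro2.Tail2DSevIdent20S2
import Summits.Ventures.PercRepro2.Tail2DSevIdent20T1
import Summits.Ventures.PercRepro2.Tail2DSevIdent20T2
import Summits.Ventures.PercRepro2.Tail2DSevIdent20Z

/-!
# (SD) at EVERY clipped position on seven identical flow-one factors
(seat mine-b, cell pub-perc-repro2; conjectures/MINE-B.md §44)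

The red-heavy positions `(2,0)`, `(3,0)`, `(4,0)`, `(5,0)`, `(3,1)`, `(4,1)` by the explicit one-change
tables (`Tail2DSevIdent*`), the blue-heavy ones by the colour swap, the rest by the top / sub-top / diagonal /
axis theorems and the empty tails.
-/

namespace Summit.Ventures.PercRepro2.Tail2D

open V2Closure Finset

namespace Seven

variable {Y : V2Closure.SP}

/-- `(1,1)` by the colour swap -/
theorem sdomZ_seven_11 (hY : FlowOne Y) (hR : 0 < (rSet Y).card) : SDomZ (parFin 7 (fun _ => Y)) 1 1 := by
  have h := IdentSev20.sdomZ_ident_Sev20 hY hR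
  rw [sdomZ_swap_iff] at h
  norm_num at h
  exact h

/-- `(1,2)` by the colour swap -/
theorem sdomZ_seven_12 (hY : FlowOne Y) (hR : 0 < (rSet Y).card) : SDomZ (parFin 7 (fun _ => Y)) 1 2 := by
  have h := IdentSev30.sdomZ_ident_Sev30 hY hR
  rw [sdomZ_swap_iff] at h
  norm_num at h
  exact h

/-- `(1,3)` by the colour swap -/
theorem sdomZ_seven_13 (hY : FlowOne Y) (hR : 0 < (rSet Y).card) : SDomZ (parFin 7 (fun _ => Y)) 1 3 := by
  have h := IdentSev40.sdomZ_ident_Sev40 hY hR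
  rw [sdomZ_swap_iff] at h
  norm_num at h
  exact h

/-- `(1,4)` by the colour swap -/
theorem sdomZ_seven_14 (hY : FlowOne Y) (hR : 0 < (rSet Y).card) : SDomZ (parFin 7 (fun _ => Y)) 1 4 := by
  have h := IdentSev50.sdomZ_ident_Sev50 hY hR
  rw [sdomZ_swap_iff] at h
  norm_num at h
  exact h

/-- `(2,2)` by the colour swap -/
theorem sdomZ_seven_22 (hY : FlowOne Y) (hR : 0 < (rSet Y).card) : SDomZ (parFin 7 (fun _ => Y)) 2 2 := by
  have h := IdentSev31.sdomZ_ident_Sev31 hY hR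
  rw [sdomZ_swap_iff] at h
  norm_num at h
  exact h

/-- `(2,3)` by the colour swap -/
theorem sdomZ_seven_23 (hY : FlowOne Y) (hR : 0 < (rSet Y).card) : SDomZ (parFin 7 (fun _ => Y)) 2 3 := by
  have h := IdentSev41.sdomZ_ident_Sev41 hY hR
  rw [sdomZ_swap_iff] at h
  norm_num at h
  exact h

/-- **(SD) at EVERY clipped position on seven copies of `Y`** for any flow-one `Y` with a red crossing -/
theorem sdomZ_seven_all (hY : FlowOne Y) (hR : 0 < (rSet Y).card) (u v : ℤ) :
    SDomZ (parFin 7 (fun _ => Y)) u v := by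
  have hX : ∀ i : Fin 7, FlowOne ((fun _ => Y) i) := fun _ => hY
  have hR' : ∀ i : Fin 7, 0 < (rSet ((fun _ => Y) i)).card := fun _ => hR
  by_cases haxis : u ≤ 0 ∨ v ≤ -1
  · exact sdomZ_axisComb_axis (axisComb_parFin 7 (fun _ => Y) (fun _ => ⟨hY, hR⟩)) u v haxis
  push Not at haxis
  obtain ⟨u', rfl⟩ : ∃ u' : ℕ, u = u' := ⟨u.toNat, by omega⟩
  obtain ⟨v', rfl⟩ : ∃ v' : ℕ, v = v' := ⟨v.toNat, by omega⟩
  have hu : 1 ≤ u' := by omega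
  by_cases hbig : 7 < u' + v'
  · apply sdomZ_of_tailCount_zero
    left
    rw [show ((u' : ℤ)).toNat = u' by omega, show ((v' : ℤ)).toNat = v' by omega]
    exact tailCount_parFin_eq_zero 7 _ hX u' v' hbig
  push Not at hbig
  have hu7 : u' ≤ 7 := by omega
  have hv7 : v' ≤ 7 := by omega
  interval_cases u' <;> interval_cases v'
  · have := sdomZ_parFin_diag 7 (fun _ => Y) 1 hX (by norm_num)
    push_cast at this
    simpa using this
  · exact sdomZ_seven_11 hY hR
  · exact sdomZ_seven_12 hY hR
  · exact sdomZ_seven_13 hY hR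
  · exact sdomZ_seven_14 hY hR
  · exact sdomZ_parFin_subtop_all 7 (fun _ => Y) 1 5 hX hR' (by norm_num) (by norm_num)
  · have := sdomZ_parFin_top 7 (fun _ => Y) 1 hX (by norm_num) (by norm_num)
    simpa using this
  · exact absurd hbig (by norm_num)
  · exact IdentSev20.sdomZ_ident_Sev20 hY hR
  · have := sdomZ_parFin_diag 7 (fun _ => Y) 2 hX (by norm_num)
    push_cast at this
    simpa using this
  · exact sdomZ_seven_22 hY hR
  · exact sdomZ_seven_23 hY hR
  · exact sdomZ_parFin_subtop_all 7 (fun _ => Y) 2 4 hX hR' (by norm_num) (by norm_num)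
  · have := sdomZ_parFin_top 7 (fun _ => Y) 2 hX (by norm_num) (by norm_num)
    simpa using this
  · exact absurd hbig (by norm_num)
  · exact absurd hbig (by norm_num)
  · exact IdentSev30.sdomZ_ident_Sev30 hY hR
  · exact IdentSev31.sdomZ_ident_Sev31 hY hR
  · have := sdomZ_parFin_diag 7 (fun _ => Y) 3 hX (by norm_num)
    push_cast at this
    simpa using this
  · exact sdomZ_parFin_subtop_all 7 (fun _ => Y) 3 3 hX hR' (by norm_num) (by norm_num)
  · have := sdomZ_parFin_top 7 (fun _ => Y) 3 hX (by norm_num) (by norm_num)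
    simpa using this
  · exact absurd hbig (by norm_num)
  · exact absurd hbig (by norm_num)
  · exact absurd hbig (by norm_num)
  · exact IdentSev40.sdomZ_ident_Sev40 hY hR
  · exact IdentSev41.sdomZ_ident_Sev41 hY hR
  · exact sdomZ_parFin_subtop_all 7 (fun _ => Y) 4 2 hX hR' (by norm_num) (by norm_num)
  · have := sdomZ_parFin_top 7 (fun _ => Y) 4 hX (by norm_num) (by norm_num)
    simpa using this
  · exact absurd hbig (by norm_num)
  · exact absurd hbig (by norm_num)
  · exact absurd hbig (by norm_num)
  · exact absurd hbig (by norm_num)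
  · exact IdentSev50.sdomZ_ident_Sev50 hY hR
  · exact sdomZ_parFin_subtop_all 7 (fun _ => Y) 5 1 hX hR' (by norm_num) (by norm_num)
  · have := sdomZ_parFin_top 7 (fun _ => Y) 5 hX (by norm_num) (by norm_num)
    simpa using this
  · exact absurd hbig (by norm_num)
  · exact absurd hbig (by norm_num)
  · exact absurd hbig (by norm_num)
  · exact absurd hbig (by norm_num)
  · exact absurd hbig (by norm_num)
  · exact sdomZ_parFin_subtop_all 7 (fun _ => Y) 6 0 hX hR' (by norm_num) (by norm_num)
  · have := sdomZ_parFin_top 7 (fun _ => Y) 6 hX (by norm_num) (by norm_num)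
    simpa using this
  · exact absurd hbig (by norm_num)
  · exact absurd hbig (by norm_num)
  · exact absurd hbig (by norm_num)
  · exact absurd hbig (by norm_num)
  · exact absurd hbig (by norm_num)
  · exact absurd hbig (by norm_num)
  · have := sdomZ_parFin_top 7 (fun _ => Y) 7 hX (by norm_num) (by norm_num)
    simpa using this
  · exact absurd hbig (by norm_num)
  · exact absurd hbig (by norm_num)
  · exact absurd hbig (by norm_num)
  · exact absurd hbig (by norm_num)
  · exact absurd hbig (by norm_num)
  · exact absurd hbig (by norm_num)
  · exact absurd hbig (by norm_num)

end Seven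

end Summit.Ventures.PercRepro2.Tail2D
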